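import Summits.RiemannHypothesis.RiemannHypothesis.Theses.ScrewFabry
import HarnessLib

/-!
# Route ScrewFabry (X-16 «FABRY EXCHANGE») — `Assembly` (item stmt-RiemannHypothesis-23060)

`FabryFact → FabryBridge → SectorExchange → ThinWallOne → RiemannHypothesis` is three lines of logic over
the landed row X-10: unpack the rate `Δ` with its Ψ-side windowed-density clause and its zero-side wall-free
sector from `SectorExchange`; `FabryBridge` (fed with the named fact `FabryFact`) at step `h = 1` turns them
into `LatticeCeiling 1`; `ScrewLatticeThinWall.rh_of_latticeCeiling_of_thinWall one_pos` with `ThinWallOne`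
(= `ThinWall 1`) gives RH. This is referee rh-split-ref-2 g6's G1 port (CENSUS #33) of the planner's
`assembly_holds` (rh-idea-1 g0, Sketch5.lean), typed by the route decl (route file sha16 dcf5d562850339a8).
CONDITIONAL bookkeeping: `FabryFact` is a print theorem in hypothesis position (Fabry–Pólya; Eremenko
arXiv:0709.2360 Thm A), the RH-free crux `FabryBridge` and the RH-implied `SectorExchange`, `ThinWallOne`
stay OPEN — RH is not proved by this; nothing here bears on the truth of RH.
-/

-- D-0017: `Summit.RiemannHypothesis.RiemannHypothesis.…` duplicates the namespace BY DESIGN (single-problem summit).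
set_option linter.dupNamespace false

namespace Summit.RiemannHypothesis.RiemannHypothesis.Theorems.ScrewFabry

open Summit.RiemannHypothesis.RiemannHypothesis.Theorems.Splittings in
/-- **`Assembly` (item stmt-RiemannHypothesis-23060) holds**: `SectorExchange` supplies `Δ` with the density
and sector clauses, `FabryBridge FabryFact 1 one_pos Δ …` is `LatticeCeiling 1`, and row X-10
`rh_of_latticeCeiling_of_thinWall` with `ThinWall 1` gives RH. Pure logic (ref-2 g6 G1). -/
theorem assembly_proof :
    Summit.RiemannHypothesis.RiemannHypothesis.Theses.ScrewFabry.Assembly := by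
  rintro hF hB ⟨Δ, hΔ, hN, hZ⟩ hT
  exact ScrewLatticeThinWall.rh_of_latticeCeiling_of_thinWall one_pos (hB hF 1 one_pos Δ hΔ hN hZ) hT

end Summit.RiemannHypothesis.RiemannHypothesis.Theorems.ScrewFabry
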